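import Literature.NumberTheory.Sieve.BombieriFriedlanderIwaniecDispersionR1Second
import Literature.NumberTheory.Sieve.BombieriFriedlanderIwaniecSiegelWalfisz
import HarnessLib

/-!
# Bombieri–Friedlander–Iwaniec 1986, §9: the core bound (9.7)–(9.13) for `ℛ₁`

Topic `Literature/NumberTheory/Sieve`.  Fourth file of the formalisation of the provable part of
§9 of E. Bombieri, J. B. Friedlander, H. Iwaniec, *Primes in arithmetic progressions to large
moduli*, Acta Math. 156 (1986), 203–251 (toward **Theorem 2**, the named fact
`Literature.NumberTheory.Sieve.BombieriFriedlanderIwaniecTheorem2`), after `…DispersionSeparation`,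
`…DispersionB`, `…DispersionR1Second`.  It PROVES the analytic heart of §9: starting from the core
sum `Core_σ(δ; 𝒦)` of `…DispersionR1Second` (the sum (9.2) after (9.3)–(9.6)), it detects the
conditions (9.4)–(9.5) by multiplicative characters modulo `δq₀k` and additive characters modulo
`T` ((9.7)–(9.9)), separates `f̂` by Fourier inversion and dilation ((9.10)–(9.11)), and applies
Cauchy's inequality with the multiplicity of `c = n₁q₂` ((9.12)–(9.13)), arriving at a bound for
`‖Core_σ(δ; 𝒦)‖` by `(#𝒦 Γ² ‖β‖²)^{1/2} (D_τ L)^{1/2}` times explicit factors, where `L` is any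
bound for the sum `𝓑_m` of (9.14) (`BFI.dispBm`, `m = δq₀`) at the twisted coefficients — the
quantity that BFI's Lemma 7 controls.  Everything here is PROVED; no named facts are introduced.

## Contents

* Stage A (detection): `BFI.gkFun` (the geometric sum `G_k(t)`), `BFI.norm_gkFun_le`,
  `BFI.natFloor_lt_int_iff`, `BFI.int_le_natFloor_iff`, `BFI.kCond_iff`,
  `BFI.dvd_sub_iff_unit_and_eq`, **`BFI.kCond_indicator_eq`**:
  `[KCond σ] = (φ(mk)⁻¹ ∑_{χ (mod mk)} conj χ(n₁) χ(n₂)) · (T⁻¹ ∑_{t<T} e(tσ(n₂−n₁)/T) G_k(t))`.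
* Stage B (rearrangement): `BFI.twist`, **`BFI.betaStar`** (`β*(h,n) = 1_{n∼N} β_n e(tσn/T) e(ησnv) e(−vh)`,
  `|β*| ≤ |β|`), `BFI.phaseSum`, `BFI.conj_e`, **`BFI.detected_sum_eq`**
  (the `(n₁,n₂)`-sum for fixed `k, q₁, q₂, v, η` as a combination over `χ, t` of the inner sums
  `BFI.bInner` of `𝓑` at `c = n₁q₂`, `d = q₁`).
* Stage C (Fourier representation): `BFI.continuous_e_mul`, `BFI.continuous_phaseSum`,
  `BFI.norm_phaseSum_le`, **`BFI.coreTerm_eq_integral`** (`coreTerm = ∫_{0<v≤V} f(Dv) phaseSum(v) dv`,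
  `D = q₁q₂σ(n₂−n₁)/k`), **`BFI.bumpC_D_eq_integral`** (`f(Dv) = λ∫ e(ησ(n₂−n₁)v) 𝓕f(λη) dη`,
  `λ = k/(q₁q₂)`), `BFI.dVal`, `BFI.dVal_bounds`, `BFI.vIntegrand`, **`BFI.coreSum_eq_integral`**
  (`Core = ∫_{0<v≤V} I(v) dv`, `V = 3Mq₀/(Q²R)` = BFI's `Y`), `BFI.lamVal`, `BFI.nnSum`,
  `BFI.etaIntegrand`, **`BFI.vIntegrand_eq_integral`** (`I(v) = ∫ J(v,η) dη`).
* Stage D (the bound): `BFI.card_fiber_mul_le`, `BFI.sum_comm₄`, `BFI.sum_comm₃`,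
  **`BFI.norm_etaIntegrand_le`** and **`BFI.norm_coreSum_le`**:
  `‖Core_σ(δ;𝒦)‖ ≤ V · 2π(λ₂(M+2Y)B₀/λ₁)^{1/2} · T⁻¹(2V_g + T(1+log T)) · (#𝒦 Γ² ‖β‖²)^{1/2} (D_τ L)^{1/2}`
  for a block `𝒦` on which `k/(q₁q₂) ∈ [λ₁, λ₂]`, `Γ = ∑_{q₀q∼Q} γ_{q₀q}²`, `D_τ ≥ τ(c)` (`c ≤ 4NQ`),
  and `L ≥ 𝓑_m(σa; 4NQ, 2Q, N/R, H, 2N; β*)` for all twists.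

## Faithfulness (what is and is not BFI's)

The route is BFI's (9.7)–(9.13) with three points made rigorous, all costing at most constants and
a logarithm: (i) the congruence `n₁ ≡ n₂ (mod δq₀k)` of (9.4) is detected by the characters modulo
`δq₀k` (BFI: modulo `k` and modulo `δq₀` separately, which requires `(k, δq₀) = 1`), hence `𝓑`
appears with the character average over `χ (mod mk)`, `m = δq₀` (`BFI.dispBm` of `…DispersionB`);
(ii) the interval condition (9.5) is detected modulo a finite `T` instead of by `∫₀¹ … F(α)dα`;
(iii) the weight `|f̂(ηk/(q₁q₂))| k/(q₁q₂)` of (9.10) depends on the outer variables, so a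
majorant uniform over a block `k/(q₁q₂) ∈ [λ₁, λ₂]` (`…DispersionSeparation`) is used and the
suprema over the twists are taken before integrating; (iv) in (9.12) the `h`-sum is kept inside
the absolute value (as in (9.14)); with the printed (9.12)–(9.13) (`|·|` after `∑_h`, prefactor
`x^ε M N^{1/2} Q^{−1/2} R^{−3/2}`) the printed range of Theorem 2 would not follow from (9.20),
whereas the present form gives the prefactor `M N^{1/2} Q^{−1} R^{−3/2}` (up to `q₀`, logarithms
and `x^ε`) and then exactly the three printed conditions.  The choice of `T, V_g, V`, the dyadic
blocks and the sums over `δ, q₀`, and Lemma 7 ⇒ `L`, are in `…DispersionR1SecondBound`.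

## References

* E. Bombieri, J. B. Friedlander, H. Iwaniec, Acta Math. 156 (1986), 203–251, §9 (9.7)–(9.13),
  pp. 228–229. [BombieriFriedlanderIwaniecActa1986]
-/

noncomputable section

open Finset Real MeasureTheory Complex
open scoped FourierTransform ArithmeticFunction.sigma

namespace Literature.NumberTheory.Sieve

namespace BFI

/-! ### Stage A: the scalar detection identity `[KCond] = charDet · addDet` under `(n₁q₂, n₂q₁) = 1` -/

/-- The geometric sum `G_k(t) = ∑_{⌊q₀kR⌋ < s ≤ ⌊2q₀kR⌋} e(−ts/T)` of the additive detection. [folklore] -/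
def gkFun (T : ℕ) (R : ℝ) (q₀ k t : ℕ) : ℂ :=
  ∑ s ∈ Finset.Ioc ⌊(q₀ : ℝ) * k * R⌋₊ ⌊2 * ((q₀ : ℝ) * k * R)⌋₊, (𝐞 (-((t : ℝ) * s / T)) : ℂ)

/-- `|G_k(t)| ≤ min(V, 1/(2‖t/T‖))` whenever the interval has at most `V` integers. [folklore] -/
theorem norm_gkFun_le {T : ℕ} {R V : ℝ} (hV0 : 0 ≤ V) {q₀ k : ℕ}
    (hV : (⌊2 * ((q₀ : ℝ) * k * R)⌋₊ : ℝ) - ⌊(q₀ : ℝ) * k * R⌋₊ ≤ V) (t : ℕ) :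
    ‖gkFun T R q₀ k t‖ ≤ Vinogradov.geomBound V ((t : ℝ) / T) := by
  unfold gkFun
  have hlen : (((⌊2 * ((q₀ : ℝ) * k * R)⌋₊ - ⌊(q₀ : ℝ) * k * R⌋₊ : ℕ)) : ℝ) ≤ V := by
    rcases le_or_gt ⌊(q₀ : ℝ) * k * R⌋₊ ⌊2 * ((q₀ : ℝ) * k * R)⌋₊ with hle | hlt
    · rw [Nat.cast_sub hle]; exact hV
    · rw [Nat.sub_eq_zero_of_le hlt.le]; simpa using hV0
  have h := Vinogradov.norm_sum_Ioc_fourierChar_le_geomBound (a := ⌊(q₀ : ℝ) * k * R⌋₊)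
    (b := ⌊2 * ((q₀ : ℝ) * k * R)⌋₊) (-((t : ℝ) / T)) hlen
  rw [Vinogradov.geomBound_neg] at h
  refine le_trans (le_of_eq ?_) h
  congr 1
  refine Finset.sum_congr rfl fun s _ => ?_
  congr 2
  ring


/-- For `x ≥ 0` and an integer `l`: `⌊x⌋₊ < l ↔ x < l`. [folklore] -/
theorem natFloor_lt_int_iff {x : ℝ} (hx : 0 ≤ x) (l : ℤ) : (⌊x⌋₊ : ℤ) < l ↔ x < l := by
  rcases le_or_gt l 0 with hl | hl
  · constructor
    · intro h; omega
    · intro h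
      have : (l : ℝ) ≤ 0 := by exact_mod_cast hl
      linarith
  · have hl' : ((l.toNat : ℕ) : ℤ) = l := Int.toNat_of_nonneg hl.le
    have hlR : ((l.toNat : ℕ) : ℝ) = l := by exact_mod_cast hl'
    rw [← hlR, ← Nat.floor_lt hx]
    omega

/-- For `x ≥ 0` and an integer `l`: `l ≤ ⌊x⌋₊ ↔ l ≤ x`. [folklore] -/
theorem int_le_natFloor_iff {x : ℝ} (hx : 0 ≤ x) (l : ℤ) : l ≤ (⌊x⌋₊ : ℤ) ↔ (l : ℝ) ≤ x := by
  rcases lt_or_ge l 0 with hl | hl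
  · constructor
    · intro _
      have : (l : ℝ) < 0 := by exact_mod_cast hl
      linarith
    · intro _; omega
  · have hl' : ((l.toNat : ℕ) : ℤ) = l := Int.toNat_of_nonneg hl
    have hlR : ((l.toNat : ℕ) : ℝ) = l := by exact_mod_cast hl'
    rw [← hlR, ← Nat.le_floor_iff hx]
    omega

/-- `KCond` in integer form: `δq₀k ∣ n₂ − n₁` and `⌊q₀kR⌋ < σ(n₂−n₁) ≤ ⌊2q₀kR⌋`. [folklore] -/
theorem kCond_iff {sg : ℤ} {R : ℝ} (hR : 0 ≤ R) {q₀ δ k : ℕ} (hq₀ : 0 < q₀) (hk : 0 < k)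
    (n₁ n₂ : ℕ) :
    KCond sg R q₀ δ k n₁ n₂ ↔ ((δ * q₀ * k : ℕ) : ℤ) ∣ ((n₂ : ℤ) - n₁) ∧
      ((⌊(q₀ : ℝ) * k * R⌋₊ : ℤ) < sg * ((n₂ : ℤ) - n₁) ∧
        sg * ((n₂ : ℤ) - n₁) ≤ (⌊2 * ((q₀ : ℝ) * k * R)⌋₊ : ℤ)) := by
  have hx : 0 ≤ (q₀ : ℝ) * k * R := by positivity
  have hq0k : (0 : ℝ) < q₀ * k := by positivity
  unfold KCond
  rw [natFloor_lt_int_iff hx, int_le_natFloor_iff (by positivity), div_le_iff₀ hq0k,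
    lt_div_iff₀ hq0k]
  push_cast
  constructor
  · rintro ⟨h1, h2, h3⟩; exact ⟨h1, by linarith, by linarith⟩
  · rintro ⟨h1, h2, h3⟩; exact ⟨h1, by linarith, by linarith⟩

/-- Under `(n₁q₂, n₂q₁) = 1`: `q ∣ n₂ − n₁ ↔ n₁ is a unit (mod q) congruent to n₂`. [folklore] -/
theorem dvd_sub_iff_unit_and_eq {q : ℕ} {q₁ q₂ n₁ n₂ : ℕ}
    (hcop : (n₁ * q₂).Coprime (n₂ * q₁)) :
    (q : ℤ) ∣ ((n₂ : ℤ) - n₁) ↔ IsUnit (n₁ : ZMod q) ∧ (n₁ : ZMod q) = (n₂ : ZMod q) := by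
  have heq : (n₁ : ZMod q) = (n₂ : ZMod q) ↔ (q : ℤ) ∣ ((n₂ : ℤ) - n₁) := by
    rw [← Int.cast_natCast (R := ZMod q) n₁, ← Int.cast_natCast (R := ZMod q) n₂]
    exact ZMod.intCast_eq_intCast_iff_dvd_sub _ _ _
  constructor
  · intro hd
    refine ⟨?_, heq.2 hd⟩
    rw [ZMod.isUnit_iff_coprime]
    exact coprime_of_dvd_sub (coprime_of_cop hcop) hd
  · intro h; exact heq.1 h.2

/-- **Stage A: the detection identity** (BFI (9.7)–(9.8), p. 228, in rigorous form): for
`(n₁q₂, n₂q₁) = 1`, `k ≥ 1` and `T` exceeding the relevant differences,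
`[KCond σ] = (φ(mk)⁻¹ ∑_{χ (mod mk)} conj χ(n₁) χ(n₂)) · (T⁻¹ ∑_{t<T} e(tσ(n₂−n₁)/T) G_k(t))`,
`m = δq₀`. [cite: BombieriFriedlanderIwaniecActa1986, §9 (9.7)–(9.8) p. 228] -/
theorem kCond_indicator_eq {sg : ℤ} {R : ℝ} (hR : 0 ≤ R) {q₀ δ k : ℕ} (hq₀ : 0 < q₀) (hδ : 0 < δ)
    (hk : 0 < k) {q₁ q₂ n₁ n₂ : ℕ} (hcop : (n₁ * q₂).Coprime (n₂ * q₁)) {T : ℕ} (hT : 0 < T)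
    (hclose : ∀ s ∈ Finset.Ioc ⌊(q₀ : ℝ) * k * R⌋₊ ⌊2 * ((q₀ : ℝ) * k * R)⌋₊,
      |sg * ((n₂ : ℤ) - n₁) - (s : ℤ)| < T) :
    haveI : NeZero (δ * q₀ * k) := ⟨(Nat.mul_pos (Nat.mul_pos hδ hq₀) hk).ne'⟩
    (if KCond sg R q₀ δ k n₁ n₂ then (1 : ℂ) else 0) =
      (((Nat.totient (δ * q₀ * k) : ℂ))⁻¹ * ∑ χ : DirichletCharacter ℂ (δ * q₀ * k),
          starRingEnd ℂ (χ (n₁ : ZMod (δ * q₀ * k))) * χ (n₂ : ZMod (δ * q₀ * k))) *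
        ((T : ℂ)⁻¹ * ∑ t ∈ Finset.range T,
          (𝐞 ((t : ℝ) * ((sg * ((n₂ : ℤ) - n₁) : ℤ)) / T) : ℂ) * gkFun T R q₀ k t) := by
  have hmk : 0 < δ * q₀ * k := Nat.mul_pos (Nat.mul_pos hδ hq₀) hk
  haveI : NeZero (δ * q₀ * k) := ⟨hmk.ne'⟩
  have hφ : (Nat.totient (δ * q₀ * k) : ℂ) ≠ 0 := by
    exact_mod_cast (Nat.totient_pos.2 hmk).ne'
  -- the multiplicative part
  have hchar : ((Nat.totient (δ * q₀ * k) : ℂ))⁻¹ * ∑ χ : DirichletCharacter ℂ (δ * q₀ * k),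
      starRingEnd ℂ (χ (n₁ : ZMod (δ * q₀ * k))) * χ (n₂ : ZMod (δ * q₀ * k)) =
      if ((δ * q₀ * k : ℕ) : ℤ) ∣ ((n₂ : ℤ) - n₁) then 1 else 0 := by
    rw [sum_conj_char_mul_char]
    by_cases hd : ((δ * q₀ * k : ℕ) : ℤ) ∣ ((n₂ : ℤ) - n₁)
    · rw [if_pos ((dvd_sub_iff_unit_and_eq hcop).1 hd), if_pos hd, inv_mul_cancel₀ hφ]
    · rw [if_neg (fun h => hd ((dvd_sub_iff_unit_and_eq hcop).2 h)), if_neg hd, mul_zero]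
  -- the additive part
  have hadd : (T : ℂ)⁻¹ * ∑ t ∈ Finset.range T,
      (𝐞 ((t : ℝ) * ((sg * ((n₂ : ℤ) - n₁) : ℤ)) / T) : ℂ) * gkFun T R q₀ k t =
      if (⌊(q₀ : ℝ) * k * R⌋₊ : ℤ) < sg * ((n₂ : ℤ) - n₁) ∧
        sg * ((n₂ : ℤ) - n₁) ≤ (⌊2 * ((q₀ : ℝ) * k * R)⌋₊ : ℤ) then 1 else 0 := by
    rw [indicator_Ioc_eq_sum_e hT _ _ _ hclose]
    rfl
  rw [hchar, hadd]
  by_cases hK : KCond sg R q₀ δ k n₁ n₂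
  · rw [if_pos hK]
    obtain ⟨h1, h2⟩ := (kCond_iff hR hq₀ hk n₁ n₂ (δ := δ) (sg := sg)).1 hK
    rw [if_pos h1, if_pos h2, mul_one]
  · rw [if_neg hK]
    by_cases h1 : ((δ * q₀ * k : ℕ) : ℤ) ∣ ((n₂ : ℤ) - n₁)
    · rw [if_pos h1, if_neg (fun h2 => hK ((kCond_iff hR hq₀ hk n₁ n₂).2 ⟨h1, h2⟩)), mul_zero]
    · rw [if_neg h1, zero_mul]


/-! ### Stage B: rearranging the detected sum into the inner sums of `𝓑` -/

/-- The twist `e(tσn/T) e(ησn v)` attached to `n₂` by the two detections. [folklore] -/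
def twist (sg : ℤ) (T t : ℕ) (v η : ℝ) (n : ℕ) : ℂ :=
  (𝐞 ((t : ℝ) * (sg * n) / T) : ℂ) * (𝐞 (η * (sg * n) * v) : ℂ)

/-- The coefficients `β*(h, n) = 1_{n ∼ N} β_n e(tσn/T) e(ησnv) e(−vh)` fed to `𝓑`
(BFI p. 229: "with some `|β(h, n₂)| = |β_{n₂}|`"). [cite: BombieriFriedlanderIwaniecActa1986, §9 (9.12) p. 229] -/
def betaStar (sg : ℤ) (N : ℝ) (β : ℕ → ℝ) (T t : ℕ) (v η : ℝ) : ℕ → ℕ → ℂ := fun h n =>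
  if n ∈ dyadic N then (β n : ℂ) * twist sg T t v η n * (𝐞 (-(v * h)) : ℂ) else 0

/-- `|β*(h, n)| ≤ |β_n|`, and `β*(h, n) = 0` unless `n ∼ N`. [folklore] -/
theorem norm_betaStar_le (sg : ℤ) (N : ℝ) (β : ℕ → ℝ) (T t : ℕ) (v η : ℝ) (h n : ℕ) :
    ‖betaStar sg N β T t v η h n‖ ≤ |β n| := by
  unfold betaStar twist
  split_ifs
  · simp only [norm_mul, Complex.norm_real, Real.norm_eq_abs, Circle.norm_coe, mul_one]; rfl
  · simp

/-- `β*(h, n) = 0` unless `n ∼ N`. [folklore] -/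
theorem betaStar_eq_zero (sg : ℤ) {N : ℝ} (β : ℕ → ℝ) (T t : ℕ) (v η : ℝ) (h : ℕ) {n : ℕ}
    (hn : n ∉ dyadic N) : betaStar sg N β T t v η h n = 0 := by
  unfold betaStar; rw [if_neg hn]

/-- The `h`-sum `∑_{h ≤ H} e(−vh) e(a' h k (n₂q₁)‾/(n₁q₂))`. [folklore] -/
def phaseSum (a sg : ℤ) (H v : ℝ) (k q₁ q₂ n₁ n₂ : ℕ) : ℂ :=
  ∑ h ∈ Icc 1 ⌊H⌋₊, (𝐞 (-(v * h)) : ℂ) *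
    (𝐞 ((klNum (sg * a) (n₁ * q₂) (n₂ * q₁) : ℝ) * h * k / ((n₁ * q₂ : ℕ) : ℝ)) : ℂ)

/-- `conj e(x) = e(−x)`. [folklore] -/
theorem conj_e (x : ℝ) : starRingEnd ℂ (𝐞 x : ℂ) = (𝐞 (-x) : ℂ) := by
  rw [← Circle.coe_inv_eq_conj, AddChar.map_neg_eq_inv]

/-- **Stage B: the rearrangement** (BFI (9.7)–(9.12), p. 228–229): after detecting (9.4)–(9.5) by
characters, the `(n₁, n₂)`-sum for fixed `k, q₁, q₂` (and fixed `v, η`) is a combination, over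
`χ (mod δq₀k)` and `t (mod T)`, of the inner sums of `𝓑` at `c = n₁q₂`, `d = q₁` with the
coefficients `β*`. [cite: BombieriFriedlanderIwaniecActa1986, §9 (9.7)–(9.12) pp. 228–229] -/
theorem detected_sum_eq (a : ℤ) {sg : ℤ} {R : ℝ} (hR : 0 ≤ R) {N : ℝ} (hN : 0 ≤ N) (β : ℕ → ℝ)
    (H : ℝ) {q₀ δ k q₁ q₂ : ℕ} (hq₀ : 0 < q₀) (hδ : 0 < δ) (hk : 0 < k) {T : ℕ} (hT : 0 < T)
    (hclose : ∀ n₁ ∈ dyadic N, ∀ n₂ ∈ dyadic N,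
      ∀ s ∈ Finset.Ioc ⌊(q₀ : ℝ) * k * R⌋₊ ⌊2 * ((q₀ : ℝ) * k * R)⌋₊,
        |sg * ((n₂ : ℤ) - n₁) - (s : ℤ)| < T) (v η : ℝ) :
    haveI : NeZero (δ * q₀ * k) := ⟨(Nat.mul_pos (Nat.mul_pos hδ hq₀) hk).ne'⟩
    ∑ n₁ ∈ dyadic N, ∑ n₂ ∈ dyadic N,
        (if (n₁ * q₂).Coprime (n₂ * q₁) ∧ KCond sg R q₀ δ k n₁ n₂ then
          ((β n₁ * β n₂ : ℝ) : ℂ) * (𝐞 (η * (sg * ((n₂ : ℝ) - n₁)) * v) : ℂ) *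
            phaseSum a sg H v k q₁ q₂ n₁ n₂ else 0) =
      ((Nat.totient (δ * q₀ * k) : ℂ))⁻¹ * (T : ℂ)⁻¹ *
        ∑ χ : DirichletCharacter ℂ (δ * q₀ * k), ∑ t ∈ Finset.range T, gkFun T R q₀ k t *
          ∑ n₁ ∈ dyadic N, ((β n₁ : ℂ) * starRingEnd ℂ (χ (n₁ : ZMod (δ * q₀ * k))) *
              starRingEnd ℂ (twist sg T t v η n₁)) *
            bInner (sg * a) (δ * q₀) H (2 * N) (betaStar sg N β T t v η) (n₁ * q₂) q₁ k χ := by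
  have hmk : 0 < δ * q₀ * k := Nat.mul_pos (Nat.mul_pos hδ hq₀) hk
  haveI : NeZero (δ * q₀ * k) := ⟨hmk.ne'⟩
  set φi : ℂ := ((Nat.totient (δ * q₀ * k) : ℂ))⁻¹ with hφi
  set Ti : ℂ := (T : ℂ)⁻¹ with hTi
  -- the common summand
  set Y : DirichletCharacter ℂ (δ * q₀ * k) → ℕ → ℕ → ℕ → ℂ := fun χ t n₁ n₂ =>
    if (n₁ * q₂).Coprime (n₂ * q₁) then
      φi * Ti * gkFun T R q₀ k t *
        (((β n₁ : ℂ) * starRingEnd ℂ (χ (n₁ : ZMod (δ * q₀ * k))) *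
          starRingEnd ℂ (twist sg T t v η n₁)) *
        ∑ h ∈ Icc 1 ⌊H⌋₊, betaStar sg N β T t v η h n₂ * χ (n₂ : ZMod (δ * q₀ * k)) *
          (𝐞 ((klNum (sg * a) (n₁ * q₂) (n₂ * q₁) : ℝ) * h * k / ((n₁ * q₂ : ℕ) : ℝ)) : ℂ))
    else 0 with hY
  -- LHS, termwise
  have lhs_term : ∀ n₁ ∈ dyadic N, ∀ n₂ ∈ dyadic N,
      (if (n₁ * q₂).Coprime (n₂ * q₁) ∧ KCond sg R q₀ δ k n₁ n₂ then
          ((β n₁ * β n₂ : ℝ) : ℂ) * (𝐞 (η * (sg * ((n₂ : ℝ) - n₁)) * v) : ℂ) *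
            phaseSum a sg H v k q₁ q₂ n₁ n₂ else 0) =
        ∑ χ : DirichletCharacter ℂ (δ * q₀ * k), ∑ t ∈ Finset.range T, Y χ t n₁ n₂ := by
    intro n₁ hn₁ n₂ hn₂
    by_cases hcop : (n₁ * q₂).Coprime (n₂ * q₁)
    swap
    · rw [if_neg (fun h => hcop h.1)]
      symm
      refine Finset.sum_eq_zero fun χ _ => Finset.sum_eq_zero fun t _ => ?_
      simp only [hY]; rw [if_neg hcop]
    have key : (if (n₁ * q₂).Coprime (n₂ * q₁) ∧ KCond sg R q₀ δ k n₁ n₂ then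
        ((β n₁ * β n₂ : ℝ) : ℂ) * (𝐞 (η * (sg * ((n₂ : ℝ) - n₁)) * v) : ℂ) *
          phaseSum a sg H v k q₁ q₂ n₁ n₂ else 0) =
        (if KCond sg R q₀ δ k n₁ n₂ then (1 : ℂ) else 0) *
          (((β n₁ * β n₂ : ℝ) : ℂ) * (𝐞 (η * (sg * ((n₂ : ℝ) - n₁)) * v) : ℂ) *
            phaseSum a sg H v k q₁ q₂ n₁ n₂) := by
      by_cases hK : KCond sg R q₀ δ k n₁ n₂
      · rw [if_pos ⟨hcop, hK⟩, if_pos hK, one_mul]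
      · rw [if_neg (fun h => hK h.2), if_neg hK, zero_mul]
    rw [key, kCond_indicator_eq hR hq₀ hδ hk hcop hT (hclose n₁ hn₁ n₂ hn₂)]
    -- expand the product of the two detecting sums
    rw [Finset.mul_sum, Finset.sum_mul, Finset.sum_mul]
    refine Finset.sum_congr rfl fun χ _ => ?_
    simp only [Finset.mul_sum, Finset.sum_mul]
    refine Finset.sum_congr rfl fun t _ => ?_
    simp only [hY]
    rw [if_pos hcop]
    -- split the exponentials
    have hsplit1 : (𝐞 ((t : ℝ) * ((sg * ((n₂ : ℤ) - n₁) : ℤ)) / T) : ℂ) =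
        (𝐞 ((t : ℝ) * (sg * n₂) / T) : ℂ) * starRingEnd ℂ (𝐞 ((t : ℝ) * (sg * n₁) / T) : ℂ) := by
      rw [conj_e, ← Circle.coe_mul, ← AddChar.map_add_eq_mul]
      congr 2; push_cast; ring
    have hsplit2 : (𝐞 (η * (sg * ((n₂ : ℝ) - n₁)) * v) : ℂ) =
        (𝐞 (η * (sg * n₂) * v) : ℂ) * starRingEnd ℂ (𝐞 (η * (sg * n₁) * v) : ℂ) := by
      rw [conj_e, ← Circle.coe_mul, ← AddChar.map_add_eq_mul]
      congr 2; ring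
    rw [hsplit1, hsplit2]
    unfold phaseSum
    simp only [Finset.mul_sum]
    refine Finset.sum_congr rfl fun h _ => ?_
    unfold betaStar
    rw [if_pos hn₂]
    unfold twist
    rw [map_mul (starRingEnd ℂ)]
    push_cast
    ring
  -- RHS, termwise
  have rhs_term : ∀ (χ : DirichletCharacter ℂ (δ * q₀ * k)) (t : ℕ),
      φi * Ti * (gkFun T R q₀ k t *
        ∑ n₁ ∈ dyadic N, ((β n₁ : ℂ) * starRingEnd ℂ (χ (n₁ : ZMod (δ * q₀ * k))) *
            starRingEnd ℂ (twist sg T t v η n₁)) *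
          bInner (sg * a) (δ * q₀) H (2 * N) (betaStar sg N β T t v η) (n₁ * q₂) q₁ k χ) =
        ∑ n₁ ∈ dyadic N, ∑ n₂ ∈ dyadic N, Y χ t n₁ n₂ := by
    intro χ t
    rw [Finset.mul_sum, Finset.mul_sum]
    refine Finset.sum_congr rfl fun n₁ _ => ?_
    unfold bInner
    -- swap `h` and `n₂`, restrict `n₂` to `n ∼ N`, unfilter the coprimality
    have hswap : ∑ h ∈ Icc 1 ⌊H⌋₊,
        ∑ n ∈ (Icc 1 ⌊2 * N⌋₊).filter (fun n => (n₁ * q₂).Coprime (n * q₁)),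
          betaStar sg N β T t v η h n * χ (n : ZMod (δ * q₀ * k)) *
            (𝐞 ((klNum (sg * a) (n₁ * q₂) (n * q₁) : ℝ) * h * k / ((n₁ * q₂ : ℕ) : ℝ)) : ℂ) =
        ∑ n₂ ∈ dyadic N, if (n₁ * q₂).Coprime (n₂ * q₁) then
          ∑ h ∈ Icc 1 ⌊H⌋₊, betaStar sg N β T t v η h n₂ * χ (n₂ : ZMod (δ * q₀ * k)) *
            (𝐞 ((klNum (sg * a) (n₁ * q₂) (n₂ * q₁) : ℝ) * h * k / ((n₁ * q₂ : ℕ) : ℝ)) : ℂ)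
          else 0 := by
      rw [Finset.sum_comm]
      rw [Finset.sum_filter]
      symm
      refine Finset.sum_subset (dyadic_subset_Icc hN) fun n₂ _ hn₂ => ?_
      split_ifs
      · refine Finset.sum_eq_zero fun h _ => ?_
        rw [betaStar_eq_zero sg β T t v η h hn₂, zero_mul, zero_mul]
      · rfl
    rw [hswap]
    simp only [Finset.mul_sum]
    refine Finset.sum_congr rfl fun n₂ _ => ?_
    simp only [hY]
    split_ifs
    · simp only [Finset.mul_sum]
      refine Finset.sum_congr rfl fun h _ => ?_
      ring
    · simp
  -- both sides equal `∑_χ ∑_t ∑_{n₁} ∑_{n₂} Y`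
  rw [Finset.sum_congr rfl fun n₁ hn₁ => Finset.sum_congr rfl fun n₂ hn₂ => lhs_term n₁ hn₁ n₂ hn₂]
  rw [Finset.mul_sum]
  simp_rw [Finset.mul_sum (s := Finset.range T)]
  rw [Finset.sum_congr rfl fun χ _ => Finset.sum_congr rfl fun t _ => rhs_term χ t]
  -- reorder `∑_{n₁} ∑_{n₂} ∑_χ ∑_t = ∑_χ ∑_t ∑_{n₁} ∑_{n₂}` through the product set
  rw [← Finset.sum_product' (s := dyadic N) (t := dyadic N)
    (f := fun n₁ n₂ => ∑ χ : DirichletCharacter ℂ (δ * q₀ * k), ∑ t ∈ Finset.range T, Y χ t n₁ n₂)]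
  rw [Finset.sum_comm]
  refine Finset.sum_congr rfl fun χ _ => ?_
  rw [Finset.sum_comm]
  refine Finset.sum_congr rfl fun t _ => ?_
  rw [Finset.sum_product' (f := fun n₁ n₂ => Y χ t n₁ n₂)]


/-! ### Stage C: Fourier representation of the core terms -/

/-- Continuity of `v ↦ e(c v)` as a complex-valued function. [folklore] -/
theorem continuous_e_mul (c : ℝ) : Continuous fun v : ℝ => (𝐞 (c * v) : ℂ) :=
  continuous_subtype_val.comp (Real.continuous_fourierChar.comp (continuous_const.mul continuous_id))

/-- Continuity of `v ↦ phaseSum(v)`. [folklore] -/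
theorem continuous_phaseSum (a sg : ℤ) (H : ℝ) (k q₁ q₂ n₁ n₂ : ℕ) :
    Continuous fun v : ℝ => phaseSum a sg H v k q₁ q₂ n₁ n₂ := by
  unfold phaseSum
  refine continuous_finsetSum _ fun h _ => ?_
  refine Continuous.mul ?_ continuous_const
  have : (fun v : ℝ => (𝐞 (-(v * h)) : ℂ)) = fun v : ℝ => (𝐞 ((-(h : ℝ)) * v) : ℂ) := by
    funext v; congr 2; ring
  rw [this]
  exact continuous_e_mul _

/-- `|phaseSum(v)| ≤ H`. [folklore] -/
theorem norm_phaseSum_le (a sg : ℤ) {H : ℝ} (hH : 0 ≤ H) (v : ℝ) (k q₁ q₂ n₁ n₂ : ℕ) :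
    ‖phaseSum a sg H v k q₁ q₂ n₁ n₂‖ ≤ H := by
  unfold phaseSum
  refine (norm_sum_le _ _).trans ?_
  have : ∀ h ∈ Icc 1 ⌊H⌋₊, ‖(𝐞 (-(v * h)) : ℂ) *
      (𝐞 ((klNum (sg * a) (n₁ * q₂) (n₂ * q₁) : ℝ) * h * k / ((n₁ * q₂ : ℕ) : ℝ)) : ℂ)‖ = 1 := by
    intro h _; rw [norm_mul, Circle.norm_coe, Circle.norm_coe, mul_one]
  rw [Finset.sum_congr rfl this, Finset.sum_const, Nat.card_Icc, nsmul_eq_mul, mul_one]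
  have := Nat.floor_le hH
  push_cast
  linarith

/-- **(C1) The core term as an integral over `v`** (BFI (9.10), first step): if
`D = q₁q₂σ(n₂−n₁)/k > 0` and `V ≥ 3M/D`, then
`coreTerm = ∫_{0<v≤V} f(Dv) · phaseSum(v) dv`. [cite: BombieriFriedlanderIwaniecActa1986, §9 (9.10) p. 229] -/
theorem coreTerm_eq_integral (a sg : ℤ) {M Y : ℝ} (hY : 0 < Y) (hYM : Y ≤ M) (H : ℝ)
    {k q₁ q₂ n₁ n₂ : ℕ} {V : ℝ}
    (hD : 0 < (q₁ : ℝ) * q₂ * (sg * ((n₂ : ℝ) - n₁)) / k)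
    (hV : 3 * M / ((q₁ : ℝ) * q₂ * (sg * ((n₂ : ℝ) - n₁)) / k) ≤ V) (hk : 0 < k) :
    coreTerm a sg M Y H k q₁ q₂ n₁ n₂ =
      ∫ v in Set.Ioc 0 V, bumpC M Y ((q₁ : ℝ) * q₂ * (sg * ((n₂ : ℝ) - n₁)) / k * v) *
        phaseSum a sg H v k q₁ q₂ n₁ n₂ := by
  set D : ℝ := (q₁ : ℝ) * q₂ * (sg * ((n₂ : ℝ) - n₁)) / k with hDdef
  have hk0 : (0 : ℝ) < k := by exact_mod_cast hk
  have hM : 0 ≤ M := hY.le.trans hYM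
  -- `k/(q₁q₂σ(n₂−n₁)) = 1/D` and `hk/(q₁q₂σ(n₂−n₁)) = h/D`
  have hinv : (k : ℝ) / (q₁ * q₂ * (sg * ((n₂ : ℝ) - n₁))) = 1 / D := by
    rw [hDdef]; field_simp
  have harg : ∀ h : ℕ, (h : ℝ) * k / (q₁ * q₂ * (sg * ((n₂ : ℝ) - n₁))) = h / D := by
    intro h; rw [hDdef]; field_simp
  unfold coreTerm
  rw [hinv]
  simp_rw [harg]
  -- each Fourier coefficient as an integral
  have hF : ∀ h : ℕ, 𝓕 (bumpC M Y) ((h : ℝ) / D) =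
      (D : ℂ) * ∫ v in Set.Ioc 0 V, (𝐞 (-(v * h)) : ℂ) * bumpC M Y (D * v) :=
    fun h => fourier_bumpC_div_eq hY hYM hD hV h
  simp_rw [hF]
  -- integrability of the summands
  have hint : ∀ h ∈ Icc 1 ⌊H⌋₊, Integrable (fun v : ℝ => bumpC M Y (D * v) *
      ((𝐞 (-(v * h)) : ℂ) * (𝐞 ((klNum (sg * a) (n₁ * q₂) (n₂ * q₁) : ℝ) * h * k /
        ((n₁ * q₂ : ℕ) : ℝ)) : ℂ))) (volume.restrict (Set.Ioc 0 V)) := by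
    intro h _
    refine Continuous.integrableOn_Ioc ?_
    refine Continuous.mul ((contDiff_bumpC M Y).continuous.comp (continuous_const.mul continuous_id)) ?_
    refine Continuous.mul ?_ continuous_const
    have : (fun v : ℝ => (𝐞 (-(v * h)) : ℂ)) = fun v : ℝ => (𝐞 ((-(h : ℝ)) * v) : ℂ) := by
      funext v; congr 2; ring
    rw [this]; exact continuous_e_mul _
  unfold phaseSum
  simp_rw [Finset.mul_sum]
  rw [integral_finsetSum _ hint]
  refine Finset.sum_congr rfl fun h _ => ?_
  have hD0 : (D : ℂ) ≠ 0 := by exact_mod_cast hD.ne'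
  calc (((1 / D : ℝ)) : ℂ) * (((D : ℂ) * ∫ v in Set.Ioc 0 V, (𝐞 (-(v * h)) : ℂ) * bumpC M Y (D * v)) *
        (𝐞 ((klNum (sg * a) (n₁ * q₂) (n₂ * q₁) : ℝ) * h * k / (n₁ * q₂)) : ℂ))
      = (∫ v in Set.Ioc 0 V, (𝐞 (-(v * h)) : ℂ) * bumpC M Y (D * v)) *
        (𝐞 ((klNum (sg * a) (n₁ * q₂) (n₂ * q₁) : ℝ) * h * k / (n₁ * q₂)) : ℂ) := by
        rw [← mul_assoc, ← mul_assoc]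
        push_cast
        rw [one_div_mul_cancel hD0, one_mul]
    _ = ∫ v in Set.Ioc 0 V, ((𝐞 (-(v * h)) : ℂ) * bumpC M Y (D * v)) *
        (𝐞 ((klNum (sg * a) (n₁ * q₂) (n₂ * q₁) : ℝ) * h * k / (n₁ * q₂)) : ℂ) :=
        (integral_mul_const _ _).symm
    _ = _ := by
        refine integral_congr_ae (Filter.Eventually.of_forall fun v => ?_)
        simp only
        push_cast
        ring

/-- **(C2) The weight at `Dv` through Fourier inversion and dilation** (BFI (9.10), second step):
`f(Dv) = λ ∫ e(η σ(n₂−n₁) v) 𝓕f(λη) dη` with `λ = k/(q₁q₂)`, `D = q₁q₂σ(n₂−n₁)/k`.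
[cite: BombieriFriedlanderIwaniecActa1986, §9 (9.10) p. 229] -/
theorem bumpC_D_eq_integral {M Y : ℝ} (hY : 0 < Y) (hM : 0 ≤ M) (sg : ℤ) {k q₁ q₂ : ℕ}
    (hk : 0 < k) (hq₁ : 0 < q₁) (hq₂ : 0 < q₂) (n₁ n₂ : ℕ) (v : ℝ) :
    bumpC M Y ((q₁ : ℝ) * q₂ * (sg * ((n₂ : ℝ) - n₁)) / k * v) =
      ((k : ℝ) / (q₁ * q₂) : ℂ) * ∫ η : ℝ, (𝐞 (η * (sg * ((n₂ : ℝ) - n₁)) * v) : ℂ) *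
        𝓕 (bumpC M Y) ((k : ℝ) / (q₁ * q₂) * η) := by
  have hlam : 0 < (k : ℝ) / (q₁ * q₂) := by positivity
  rw [bumpC_eq_integral_fourier hY hM, integral_fourier_dilate _ hlam]
  push_cast
  congr 1
  refine integral_congr_ae (Filter.Eventually.of_forall fun η => ?_)
  simp only
  congr 3
  field_simp


/-- The real number `D = q₁q₂σ(n₂−n₁)/k` (so that `q₀q₁q₂r = D` in (9.10)). [folklore] -/
def dVal (sg : ℤ) (k q₁ q₂ n₁ n₂ : ℕ) : ℝ := (q₁ : ℝ) * q₂ * (sg * ((n₂ : ℝ) - n₁)) / k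

/-- Under `KCond` (with `R > 0`, `q₀qᵢ ∼ Q`): `D > Q²R/q₀ > 0`, hence `3M/D ≤ 3Mq₀/(Q²R)`. [folklore] -/
theorem dVal_bounds {sg : ℤ} {R Q : ℝ} (hR : 0 < R) (hQ : 0 < Q) {q₀ δ k q₁ q₂ n₁ n₂ : ℕ}
    (hq₀ : 0 < q₀) (hk : 0 < k) (hq₁ : q₁ ∈ qSet Q q₀) (hq₂ : q₂ ∈ qSet Q q₀)
    (hK : KCond sg R q₀ δ k n₁ n₂) :
    Q ^ 2 * R / q₀ < dVal sg k q₁ q₂ n₁ n₂ ∧ 0 < dVal sg k q₁ q₂ n₁ n₂ := by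
  obtain ⟨_, h1, _⟩ := hK
  have hb₁ := qSet_bounds hQ.le hq₀ hq₁
  have hb₂ := qSet_bounds hQ.le hq₀ hq₂
  have hq0 : (0 : ℝ) < q₀ := by exact_mod_cast hq₀
  have hk0 : (0 : ℝ) < k := by exact_mod_cast hk
  have hq0k : (0 : ℝ) < q₀ * k := by positivity
  -- `l/k > q₀ R`
  have hl : (q₀ : ℝ) * R < sg * ((n₂ : ℝ) - n₁) / k := by
    rw [lt_div_iff₀ hq0k] at h1
    rw [lt_div_iff₀ hk0]; linarith
  have hQq : Q / q₀ < q₁ := hb₁.2.1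
  have hQq' : Q / q₀ < q₂ := hb₂.2.1
  have hQq0 : 0 < Q / q₀ := by positivity
  have hprod : (Q / q₀) ^ 2 < (q₁ : ℝ) * q₂ := by
    rw [sq]; exact mul_lt_mul'' hQq hQq' hQq0.le hQq0.le
  have hpos : 0 < Q ^ 2 * R / q₀ := by positivity
  have key : Q ^ 2 * R / q₀ < dVal sg k q₁ q₂ n₁ n₂ := by
    unfold dVal
    calc Q ^ 2 * R / q₀ = (Q / q₀) ^ 2 * (q₀ * R) := by field_simp
      _ < (q₁ : ℝ) * q₂ * (sg * ((n₂ : ℝ) - n₁) / k) :=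
          mul_lt_mul'' hprod hl (by positivity) (by positivity)
      _ = _ := by ring
  exact ⟨key, hpos.trans key⟩

/-- **The integrand in `v`** of the core sum after (9.10), first step:
`I(v) = ∑_{k,q₁,q₂,n₁,n₂} [conditions] γγββ f(Dv) phaseSum(v)`. [folklore] -/
def vIntegrand (a sg : ℤ) (M Y N Q R H : ℝ) (β γ : ℕ → ℝ) (q₀ δ : ℕ) (Kset : Finset ℕ)
    (v : ℝ) : ℂ :=
  ∑ k ∈ Kset, ∑ q₁ ∈ qSet Q q₀, ∑ q₂ ∈ qSet Q q₀,
    if q₁.Coprime q₂ ∧ (q₀ * q₁ * q₂).Coprime a.natAbs then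
      ((γ (q₀ * q₁) * γ (q₀ * q₂) : ℝ) : ℂ) * ∑ n₁ ∈ dyadic N, ∑ n₂ ∈ dyadic N,
        if CoreCond sg R q₀ δ k q₁ q₂ n₁ n₂ then
          ((β n₁ * β n₂ : ℝ) : ℂ) * (bumpC M Y (dVal sg k q₁ q₂ n₁ n₂ * v) *
            phaseSum a sg H v k q₁ q₂ n₁ n₂) else 0
    else 0

/-- The `(n₁,n₂)`-term of `I(v)` is continuous in `v`. [folklore] -/
theorem continuous_vTerm (a sg : ℤ) (M Y H : ℝ) (β : ℕ → ℝ) (R : ℝ) (q₀ δ k q₁ q₂ n₁ n₂ : ℕ) :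
    Continuous fun v : ℝ => (if CoreCond sg R q₀ δ k q₁ q₂ n₁ n₂ then
      ((β n₁ * β n₂ : ℝ) : ℂ) * (bumpC M Y (dVal sg k q₁ q₂ n₁ n₂ * v) *
        phaseSum a sg H v k q₁ q₂ n₁ n₂) else 0 : ℂ) := by
  split_ifs
  · exact continuous_const.mul (((contDiff_bumpC M Y).continuous.comp
      (continuous_const.mul continuous_id)).mul (continuous_phaseSum a sg H k q₁ q₂ n₁ n₂))
  · exact continuous_const

/-- The `(k,q₁,q₂)`-term of `I(v)` is continuous in `v`. [folklore] -/
theorem continuous_vTerm₃ (a sg : ℤ) (M Y N R H : ℝ) (β γ : ℕ → ℝ) (A q₀ δ k q₁ q₂ : ℕ) :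
    Continuous fun v : ℝ => (if q₁.Coprime q₂ ∧ (q₀ * q₁ * q₂).Coprime A then
      ((γ (q₀ * q₁) * γ (q₀ * q₂) : ℝ) : ℂ) * ∑ n₁ ∈ dyadic N, ∑ n₂ ∈ dyadic N,
        if CoreCond sg R q₀ δ k q₁ q₂ n₁ n₂ then
          ((β n₁ * β n₂ : ℝ) : ℂ) * (bumpC M Y (dVal sg k q₁ q₂ n₁ n₂ * v) *
            phaseSum a sg H v k q₁ q₂ n₁ n₂) else 0
      else 0 : ℂ) := by
  split_ifs
  · refine continuous_const.mul (continuous_finsetSum _ fun n₁ _ =>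
      continuous_finsetSum _ fun n₂ _ => continuous_vTerm a sg M Y H β R q₀ δ k q₁ q₂ n₁ n₂)
  · exact continuous_const

/-- **(X1) The core sum as an integral over `v`**:
`Core(𝒦) = ∫_{0 < v ≤ V} I(v) dv` for `V ≥ 3Mq₀/(Q²R)`. [cite: BombieriFriedlanderIwaniecActa1986, §9 (9.10) p. 229] -/
theorem coreSum_eq_integral (a : ℤ) (sg : ℤ) {M Y : ℝ} (hY : 0 < Y) (hYM : Y ≤ M) {N Q R : ℝ}
    (hQ : 0 < Q) (hR : 0 < R) (H : ℝ) (β γ : ℕ → ℝ) {q₀ δ : ℕ} (hq₀ : 0 < q₀) {Kset : Finset ℕ}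
    (hK : ∀ k ∈ Kset, 0 < k) {V : ℝ} (hV : 3 * M * q₀ / (Q ^ 2 * R) ≤ V) :
    coreSum a sg M Y N Q R H β γ q₀ δ Kset =
      ∫ v in Set.Ioc 0 V, vIntegrand a sg M Y N Q R H β γ q₀ δ Kset v := by
  have hM : 0 ≤ M := hY.le.trans hYM
  unfold vIntegrand coreSum
  -- distribute the integral over the three outer sums
  rw [integral_finsetSum _ fun k _ => (continuous_finsetSum _ fun q₁ _ =>
    continuous_finsetSum _ fun q₂ _ =>
      continuous_vTerm₃ a sg M Y N R H β γ a.natAbs q₀ δ k q₁ q₂).integrableOn_Ioc]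
  refine Finset.sum_congr rfl fun k hk => ?_
  rw [integral_finsetSum _ fun q₁ _ => (continuous_finsetSum _ fun q₂ _ =>
      continuous_vTerm₃ a sg M Y N R H β γ a.natAbs q₀ δ k q₁ q₂).integrableOn_Ioc]
  refine Finset.sum_congr rfl fun q₁ hq₁ => ?_
  rw [integral_finsetSum _ fun q₂ _ =>
      (continuous_vTerm₃ a sg M Y N R H β γ a.natAbs q₀ δ k q₁ q₂).integrableOn_Ioc]
  refine Finset.sum_congr rfl fun q₂ hq₂ => ?_
  by_cases hP : q₁.Coprime q₂ ∧ (q₀ * q₁ * q₂).Coprime a.natAbs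
  swap
  · simp only [if_neg hP, integral_zero]
  simp only [if_pos hP]
  rw [integral_const_mul]
  congr 1
  rw [integral_finsetSum _ fun n₁ _ => (continuous_finsetSum _ fun n₂ _ =>
      continuous_vTerm a sg M Y H β R q₀ δ k q₁ q₂ n₁ n₂).integrableOn_Ioc]
  refine Finset.sum_congr rfl fun n₁ _ => ?_
  rw [integral_finsetSum _ fun n₂ _ =>
      (continuous_vTerm a sg M Y H β R q₀ δ k q₁ q₂ n₁ n₂).integrableOn_Ioc]
  refine Finset.sum_congr rfl fun n₂ _ => ?_
  by_cases hC : CoreCond sg R q₀ δ k q₁ q₂ n₁ n₂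
  swap
  · simp only [if_neg hC, integral_zero]
  simp only [if_pos hC]
  rw [integral_const_mul]
  congr 1
  have hb := dVal_bounds hR hQ hq₀ (hK k hk) hq₁ hq₂ hC.2 (δ := δ)
  have hV' : 3 * M / dVal sg k q₁ q₂ n₁ n₂ ≤ V := by
    refine le_trans ?_ hV
    have hq0 : (0 : ℝ) < q₀ := by exact_mod_cast hq₀
    have h1 : 3 * M / dVal sg k q₁ q₂ n₁ n₂ ≤ 3 * M / (Q ^ 2 * R / q₀) :=
      div_le_div_of_nonneg_left (by positivity) (by positivity) hb.1.le
    refine h1.trans (le_of_eq ?_)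
    field_simp
  exact coreTerm_eq_integral a sg hY hYM H hb.2 hV' (hK k hk)


/-- The dilation parameter `λ = k/(q₁q₂)` of (9.10)–(9.11). [folklore] -/
def lamVal (k q₁ q₂ : ℕ) : ℝ := (k : ℝ) / (q₁ * q₂)

/-- The `(n₁,n₂)`-sum of Stage B's left side (fixed `k, q₁, q₂, v, η`). [folklore] -/
def nnSum (a sg : ℤ) (N R H : ℝ) (β : ℕ → ℝ) (q₀ δ k q₁ q₂ : ℕ) (v η : ℝ) : ℂ :=
  ∑ n₁ ∈ dyadic N, ∑ n₂ ∈ dyadic N,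
    (if (n₁ * q₂).Coprime (n₂ * q₁) ∧ KCond sg R q₀ δ k n₁ n₂ then
      ((β n₁ * β n₂ : ℝ) : ℂ) * (𝐞 (η * (sg * ((n₂ : ℝ) - n₁)) * v) : ℂ) *
        phaseSum a sg H v k q₁ q₂ n₁ n₂ else 0)

/-- `nnSum` is continuous in `η`. [folklore] -/
theorem continuous_nnSum (a sg : ℤ) (N R H : ℝ) (β : ℕ → ℝ) (q₀ δ k q₁ q₂ : ℕ) (v : ℝ) :
    Continuous fun η : ℝ => nnSum a sg N R H β q₀ δ k q₁ q₂ v η := by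
  unfold nnSum
  refine continuous_finsetSum _ fun n₁ _ => continuous_finsetSum _ fun n₂ _ => ?_
  split_ifs
  · refine (continuous_const.mul ?_).mul continuous_const
    have : (fun η : ℝ => (𝐞 (η * (sg * ((n₂ : ℝ) - n₁)) * v) : ℂ)) =
        fun η : ℝ => (𝐞 ((sg * ((n₂ : ℝ) - n₁) * v) * η) : ℂ) := by
      funext η; congr 2; ring
    rw [this]; exact continuous_e_mul _
  · exact continuous_const

/-- `|nnSum| ≤ (∑_{n∼N} |β_n|)² H`. [folklore] -/
theorem norm_nnSum_le (a sg : ℤ) (N R : ℝ) {H : ℝ} (hH : 0 ≤ H) (β : ℕ → ℝ) (q₀ δ k q₁ q₂ : ℕ)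
    (v η : ℝ) : ‖nnSum a sg N R H β q₀ δ k q₁ q₂ v η‖ ≤ (∑ n ∈ dyadic N, |β n|) ^ 2 * H := by
  unfold nnSum
  refine (norm_sum_le _ _).trans ?_
  have hterm : ∀ n₁ ∈ dyadic N, ‖∑ n₂ ∈ dyadic N,
      (if (n₁ * q₂).Coprime (n₂ * q₁) ∧ KCond sg R q₀ δ k n₁ n₂ then
        ((β n₁ * β n₂ : ℝ) : ℂ) * (𝐞 (η * (sg * ((n₂ : ℝ) - n₁)) * v) : ℂ) *
          phaseSum a sg H v k q₁ q₂ n₁ n₂ else 0)‖ ≤ |β n₁| * ((∑ n ∈ dyadic N, |β n|) * H) := by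
    intro n₁ _
    refine (norm_sum_le _ _).trans ?_
    rw [Finset.sum_mul, Finset.mul_sum]
    refine Finset.sum_le_sum fun n₂ _ => ?_
    split_ifs
    · rw [norm_mul, norm_mul, Circle.norm_coe, mul_one, Complex.norm_real, Real.norm_eq_abs,
        abs_mul]
      calc |β n₁| * |β n₂| * ‖phaseSum a sg H v k q₁ q₂ n₁ n₂‖ ≤ |β n₁| * |β n₂| * H := by
            gcongr; exact norm_phaseSum_le a sg hH v k q₁ q₂ n₁ n₂
        _ = _ := by ring
    · rw [norm_zero]; positivity
  refine (Finset.sum_le_sum hterm).trans (le_of_eq ?_)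
  rw [← Finset.sum_mul, sq]; ring

/-- **The integrand in `(v, η)`**:
`J(v,η) = ∑_{k,q₁,q₂} [P] γγ · λ𝓕f(λη) · nnSum(v,η)`. [folklore] -/
def etaIntegrand (a sg : ℤ) (M Y N Q R H : ℝ) (β γ : ℕ → ℝ) (q₀ δ : ℕ) (Kset : Finset ℕ)
    (v η : ℝ) : ℂ :=
  ∑ k ∈ Kset, ∑ q₁ ∈ qSet Q q₀, ∑ q₂ ∈ qSet Q q₀,
    if q₁.Coprime q₂ ∧ (q₀ * q₁ * q₂).Coprime a.natAbs then
      ((γ (q₀ * q₁) * γ (q₀ * q₂) : ℝ) : ℂ) *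
        (((lamVal k q₁ q₂ : ℝ) : ℂ) * 𝓕 (bumpC M Y) (lamVal k q₁ q₂ * η)) *
          nnSum a sg N R H β q₀ δ k q₁ q₂ v η
    else 0

/-- Integrability in `η` of the `(k,q₁,q₂)`-term of `J`. [folklore] -/
theorem integrable_etaTerm (a sg : ℤ) {M Y : ℝ} (hY : 0 < Y) (hM : 0 ≤ M) (N R : ℝ) {H : ℝ}
    (hH : 0 ≤ H) (β γ : ℕ → ℝ) (A q₀ δ : ℕ) {k q₁ q₂ : ℕ} (hk : 0 < k) (hq₁ : 0 < q₁) (hq₂ : 0 < q₂)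
    (v : ℝ) :
    Integrable (fun η : ℝ => (if q₁.Coprime q₂ ∧ (q₀ * q₁ * q₂).Coprime A then
      ((γ (q₀ * q₁) * γ (q₀ * q₂) : ℝ) : ℂ) *
        (((lamVal k q₁ q₂ : ℝ) : ℂ) * 𝓕 (bumpC M Y) (lamVal k q₁ q₂ * η)) *
          nnSum a sg N R H β q₀ δ k q₁ q₂ v η
      else 0 : ℂ)) := by
  split_ifs
  · have hlam : lamVal k q₁ q₂ ≠ 0 := by unfold lamVal; positivity
    have hF : Integrable (fun η : ℝ => ((γ (q₀ * q₁) * γ (q₀ * q₂) : ℝ) : ℂ) *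
        (((lamVal k q₁ q₂ : ℝ) : ℂ) * 𝓕 (bumpC M Y) (lamVal k q₁ q₂ * η))) :=
      (((integrable_fourier_bumpC hY hM).comp_mul_left' hlam).const_mul _).const_mul _
    refine hF.mul_bdd (continuous_nnSum a sg N R H β q₀ δ k q₁ q₂ v).aestronglyMeasurable
      (Filter.Eventually.of_forall fun η => norm_nnSum_le a sg N R hH β q₀ δ k q₁ q₂ v η)
  · exact integrable_zero _ _ _

/-- **(X2) The `v`-integrand as an integral over `η`** (BFI (9.10), second step):
`I(v) = ∫ J(v, η) dη`. [cite: BombieriFriedlanderIwaniecActa1986, §9 (9.10)–(9.11) p. 229] -/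
theorem vIntegrand_eq_integral (a sg : ℤ) {M Y : ℝ} (hY : 0 < Y) (hYM : Y ≤ M) {N Q : ℝ}
    (hQ : 0 ≤ Q) (R : ℝ) {H : ℝ} (hH : 0 ≤ H) (β γ : ℕ → ℝ) {q₀ : ℕ} (hq₀ : 0 < q₀) (δ : ℕ)
    {Kset : Finset ℕ} (hK : ∀ k ∈ Kset, 0 < k) (v : ℝ) :
    vIntegrand a sg M Y N Q R H β γ q₀ δ Kset v =
      ∫ η : ℝ, etaIntegrand a sg M Y N Q R H β γ q₀ δ Kset v η := by
  have hM : 0 ≤ M := hY.le.trans hYM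
  have hSpos : ∀ q ∈ qSet Q q₀, 0 < q := fun q hq => (qSet_bounds hQ hq₀ hq).1
  unfold vIntegrand etaIntegrand
  rw [integral_finsetSum _ fun k hk => integrable_finsetSum _ fun q₁ hq₁ =>
    integrable_finsetSum _ fun q₂ hq₂ =>
      integrable_etaTerm a sg hY hM N R hH β γ a.natAbs q₀ δ (hK k hk) (hSpos q₁ hq₁) (hSpos q₂ hq₂) v]
  refine Finset.sum_congr rfl fun k hk => ?_
  rw [integral_finsetSum _ fun q₁ hq₁ => integrable_finsetSum _ fun q₂ hq₂ =>
      integrable_etaTerm a sg hY hM N R hH β γ a.natAbs q₀ δ (hK k hk) (hSpos q₁ hq₁) (hSpos q₂ hq₂) v]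
  refine Finset.sum_congr rfl fun q₁ hq₁ => ?_
  rw [integral_finsetSum _ fun q₂ hq₂ =>
      integrable_etaTerm a sg hY hM N R hH β γ a.natAbs q₀ δ (hK k hk) (hSpos q₁ hq₁) (hSpos q₂ hq₂) v]
  refine Finset.sum_congr rfl fun q₂ hq₂ => ?_
  by_cases hP : q₁.Coprime q₂ ∧ (q₀ * q₁ * q₂).Coprime a.natAbs
  swap
  · simp only [if_neg hP, integral_zero]
  simp only [if_pos hP]
  have hshape : (fun η : ℝ => ((γ (q₀ * q₁) * γ (q₀ * q₂) : ℝ) : ℂ) *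
      (((lamVal k q₁ q₂ : ℝ) : ℂ) * 𝓕 (bumpC M Y) (lamVal k q₁ q₂ * η)) *
        nnSum a sg N R H β q₀ δ k q₁ q₂ v η) = fun η : ℝ => ((γ (q₀ * q₁) * γ (q₀ * q₂) : ℝ) : ℂ) *
      ((((lamVal k q₁ q₂ : ℝ) : ℂ) * 𝓕 (bumpC M Y) (lamVal k q₁ q₂ * η)) *
        nnSum a sg N R H β q₀ δ k q₁ q₂ v η) := by
    funext η; ring
  rw [hshape, integral_const_mul]
  congr 1
  -- `∫ λ𝓕f(λη) · nnSum(η) dη = ∑∑ [CoreCond] ββ f(Dv) phaseSum(v)`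
  have hk0 := hK k hk
  have hlam : 0 < lamVal k q₁ q₂ := by
    unfold lamVal; have := hSpos q₁ hq₁; have := hSpos q₂ hq₂; positivity
  -- termwise integrability
  have hint : ∀ n₁ ∈ dyadic N, ∀ n₂ ∈ dyadic N, Integrable (fun η : ℝ =>
      (((lamVal k q₁ q₂ : ℝ) : ℂ) * 𝓕 (bumpC M Y) (lamVal k q₁ q₂ * η)) *
        (if (n₁ * q₂).Coprime (n₂ * q₁) ∧ KCond sg R q₀ δ k n₁ n₂ then
          ((β n₁ * β n₂ : ℝ) : ℂ) * (𝐞 (η * (sg * ((n₂ : ℝ) - n₁)) * v) : ℂ) *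
            phaseSum a sg H v k q₁ q₂ n₁ n₂ else 0)) := by
    intro n₁ _ n₂ _
    have hF : Integrable (fun η : ℝ =>
        (((lamVal k q₁ q₂ : ℝ) : ℂ) * 𝓕 (bumpC M Y) (lamVal k q₁ q₂ * η))) :=
      ((integrable_fourier_bumpC hY hM).comp_mul_left' hlam.ne').const_mul _
    split_ifs
    · refine hF.mul_bdd (c := |β n₁ * β n₂| * H) ?_ (Filter.Eventually.of_forall fun η => ?_)
      · refine ((continuous_const.mul ?_).mul continuous_const).aestronglyMeasurable
        have : (fun η : ℝ => (𝐞 (η * (sg * ((n₂ : ℝ) - n₁)) * v) : ℂ)) =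
            fun η : ℝ => (𝐞 ((sg * ((n₂ : ℝ) - n₁) * v) * η) : ℂ) := by
          funext η; congr 2; ring
        rw [this]; exact continuous_e_mul _
      · rw [norm_mul, norm_mul, Circle.norm_coe, mul_one, Complex.norm_real, Real.norm_eq_abs]
        gcongr; exact norm_phaseSum_le a sg hH v k q₁ q₂ n₁ n₂
    · simp only [mul_zero]; exact integrable_zero _ _ _
  unfold nnSum
  simp_rw [Finset.mul_sum]
  rw [integral_finsetSum _ fun n₁ hn₁ => integrable_finsetSum _ fun n₂ hn₂ => hint n₁ hn₁ n₂ hn₂]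
  refine Finset.sum_congr rfl fun n₁ hn₁ => ?_
  rw [integral_finsetSum _ fun n₂ hn₂ => hint n₁ hn₁ n₂ hn₂]
  refine Finset.sum_congr rfl fun n₂ hn₂ => ?_
  by_cases hC : CoreCond sg R q₀ δ k q₁ q₂ n₁ n₂
  · rw [if_pos hC]
    simp only [if_pos (show (n₁ * q₂).Coprime (n₂ * q₁) ∧ KCond sg R q₀ δ k n₁ n₂ from hC)]
    unfold dVal lamVal
    rw [bumpC_D_eq_integral hY hM sg hk0 (hSpos q₁ hq₁) (hSpos q₂ hq₂) n₁ n₂ v]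
    rw [← integral_const_mul, ← integral_mul_const, ← integral_const_mul]
    refine integral_congr_ae (Filter.Eventually.of_forall fun η => ?_)
    simp only
    push_cast
    ring
  · rw [if_neg hC]
    simp only [if_neg (show ¬((n₁ * q₂).Coprime (n₂ * q₁) ∧ KCond sg R q₀ δ k n₁ n₂) from hC),
      mul_zero, integral_zero]


/-! ### Stage D: the bound for `J(v, η)` and for the core sum -/

/-- The fibres of `(q₂, n₁) ↦ n₁ q₂` have at most `τ(c)` elements. [folklore] -/
theorem card_fiber_mul_le (S₂ 𝒩 : Finset ℕ) (h𝒩 : ∀ n ∈ 𝒩, 0 < n) (hS : ∀ q ∈ S₂, 0 < q) (c : ℕ) :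
    ((S₂ ×ˢ 𝒩).filter (fun p : ℕ × ℕ => p.2 * p.1 = c)).card ≤ c.divisors.card := by
  classical
  refine Finset.card_le_card_of_injOn (fun p : ℕ × ℕ => p.2) (fun p hp => ?_) ?_
  · rw [Finset.mem_coe, Finset.mem_filter, Finset.mem_product] at hp
    rw [Finset.mem_coe, Nat.mem_divisors]
    refine ⟨⟨p.1, hp.2.symm⟩, ?_⟩
    rw [← hp.2]; exact (Nat.mul_pos (h𝒩 _ hp.1.2) (hS _ hp.1.1)).ne'
  · intro p hp p' hp' heq
    rw [Finset.mem_coe, Finset.mem_filter, Finset.mem_product] at hp hp'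
    simp only at heq
    have h1 : p.1 = p'.1 := by
      have := hp.2.trans hp'.2.symm
      rw [heq] at this
      exact Nat.eq_of_mul_eq_mul_left (h𝒩 _ hp'.1.2) this
    exact Prod.ext h1 heq

/-- Reordering a fourfold sum: `∑_k ∑_{q₁} ∑_{q₂} ∑_t = ∑_t ∑_k ∑_{q₁} ∑_{q₂}`. [folklore] -/
theorem sum_comm₄ {α β γ δ' M : Type*} [AddCommMonoid M] (A : Finset α) (B : Finset β)
    (C : Finset γ) (D : Finset δ') (f : α → β → γ → δ' → M) :
    ∑ k ∈ A, ∑ q₁ ∈ B, ∑ q₂ ∈ C, ∑ t ∈ D, f k q₁ q₂ t =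
      ∑ t ∈ D, ∑ k ∈ A, ∑ q₁ ∈ B, ∑ q₂ ∈ C, f k q₁ q₂ t := by
  calc ∑ k ∈ A, ∑ q₁ ∈ B, ∑ q₂ ∈ C, ∑ t ∈ D, f k q₁ q₂ t
      = ∑ k ∈ A, ∑ q₁ ∈ B, ∑ t ∈ D, ∑ q₂ ∈ C, f k q₁ q₂ t :=
        Finset.sum_congr rfl fun _ _ => Finset.sum_congr rfl fun _ _ => Finset.sum_comm
    _ = ∑ k ∈ A, ∑ t ∈ D, ∑ q₁ ∈ B, ∑ q₂ ∈ C, f k q₁ q₂ t :=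
        Finset.sum_congr rfl fun _ _ => Finset.sum_comm
    _ = _ := Finset.sum_comm

/-- Reordering a threefold sum: `∑_{q₁} ∑_{q₂} ∑_x = ∑_x ∑_{q₁} ∑_{q₂}`. [folklore] -/
theorem sum_comm₃ {β γ δ' M : Type*} [AddCommMonoid M] (B : Finset β) (C : Finset γ)
    (D : Finset δ') (f : β → γ → δ' → M) :
    ∑ q₁ ∈ B, ∑ q₂ ∈ C, ∑ x ∈ D, f q₁ q₂ x = ∑ x ∈ D, ∑ q₁ ∈ B, ∑ q₂ ∈ C, f q₁ q₂ x := by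
  calc ∑ q₁ ∈ B, ∑ q₂ ∈ C, ∑ x ∈ D, f q₁ q₂ x = ∑ q₁ ∈ B, ∑ x ∈ D, ∑ q₂ ∈ C, f q₁ q₂ x :=
        Finset.sum_congr rfl fun _ _ => Finset.sum_comm
    _ = _ := Finset.sum_comm

/-- **Stage D, pointwise: the bound for `J(v, η)`** (BFI (9.11)–(9.13) with Cauchy's inequality and
the multiplicity of `c = n₁q₂`):
`|J(v,η)| ≤ Φ(η) · T⁻¹(2V_g + T(1 + log T)) · (#𝒦 Γ² ‖β‖²)^{1/2} (D_τ L)^{1/2}`,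
where `Φ` is the Lorentzian majorant of `λ|𝓕f(λη)|` on the block, `Γ = ∑_{q₀q∼Q} γ_{q₀q}²`, `D_τ`
bounds `τ(c)` for `c ≤ 4NQ`, and `L` bounds `𝓑_m` at the twisted coefficients `β*`.
[cite: BombieriFriedlanderIwaniecActa1986, §9 (9.11)–(9.13) p. 229] -/
theorem norm_etaIntegrand_le (a sg : ℤ) {M Y : ℝ} (hY : 0 < Y) (hYM : Y ≤ M) {N Q R : ℝ}
    (hN : 0 ≤ N) (hQ : 0 < Q) (hR : 0 < R) (H : ℝ) (β γ : ℕ → ℝ) {q₀ δ : ℕ}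
    (hq₀ : 0 < q₀) (hδ : 0 < δ) {Kset : Finset ℕ} (hKsub : Kset ⊆ Icc 1 ⌊N / R⌋₊)
    {lam₁ lam₂ : ℝ} (hl₁ : 0 < lam₁) (hl₁₂ : lam₁ ≤ lam₂)
    (hlam : ∀ k ∈ Kset, ∀ q₁ ∈ qSet Q q₀, ∀ q₂ ∈ qSet Q q₀,
      lam₁ ≤ lamVal k q₁ q₂ ∧ lamVal k q₁ q₂ ≤ lam₂)
    {T : ℕ} (hT : 0 < T)
    (hclose : ∀ k ∈ Kset, ∀ n₁ ∈ dyadic N, ∀ n₂ ∈ dyadic N,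
      ∀ s ∈ Finset.Ioc ⌊(q₀ : ℝ) * k * R⌋₊ ⌊2 * ((q₀ : ℝ) * k * R)⌋₊,
        |sg * ((n₂ : ℤ) - n₁) - (s : ℤ)| < T)
    {Vg : ℝ} (hVg : 0 ≤ Vg)
    (hlen : ∀ k ∈ Kset, (⌊2 * ((q₀ : ℝ) * k * R)⌋₊ : ℝ) - ⌊(q₀ : ℝ) * k * R⌋₊ ≤ Vg)
    {Dτ : ℕ} (hDτ : ∀ c ∈ Icc 1 ⌊4 * N * Q⌋₊, c.divisors.card ≤ Dτ)
    {L : ℝ} (hL : ∀ (t : ℕ) (v η : ℝ),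
      dispBm (sg * a) (δ * q₀) (4 * N * Q) (2 * Q) (N / R) H (2 * N) (betaStar sg N β T t v η) ≤ L)
    (v η : ℝ) :
    ‖etaIntegrand a sg M Y N Q R H β γ q₀ δ Kset v η‖ ≤
      lorentz (lam₂ * (M + 2 * Y)) (fourierDecayConst Y / lam₁) η *
        ((T : ℝ)⁻¹ * (2 * Vg + T * (1 + Real.log T))) *
        (Real.sqrt (Kset.card * ((∑ q ∈ qSet Q q₀, γ (q₀ * q) ^ 2) *
            (∑ q ∈ qSet Q q₀, γ (q₀ * q) ^ 2) * ∑ n ∈ dyadic N, β n ^ 2)) *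
          Real.sqrt (Dτ * L)) := by
  have hM : 0 ≤ M := hY.le.trans hYM
  set S := qSet Q q₀ with hS
  have hSpos : ∀ q ∈ S, 0 < q := fun q hq => (qSet_bounds hQ.le hq₀ hq).1
  have hKpos : ∀ k ∈ Kset, 0 < k := fun k hk => (Finset.mem_Icc.1 (hKsub hk)).1
  have hm : 0 < δ * q₀ := Nat.mul_pos hδ hq₀
  set Φ : ℝ := lorentz (lam₂ * (M + 2 * Y)) (fourierDecayConst Y / lam₁) η with hΦ
  have hl₂ : 0 < lam₂ := hl₁.trans_le hl₁₂
  have hΦ0 : 0 ≤ Φ := lorentz_nonneg (by positivity)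
    (by have := fourierDecayConst_pos hY; positivity) η
  have hT0 : (0 : ℝ) < T := by exact_mod_cast hT
  -- notation for the pieces of the bound
  set gB : ℕ → ℝ := fun t => Vinogradov.geomBound Vg ((t : ℝ) / T) with hgB
  have hgB0 : ∀ t, 0 ≤ gB t := fun t => Vinogradov.geomBound_nonneg hVg _
  set Sf : ℕ → (k : ℕ) → DirichletCharacter ℂ (δ * q₀ * k) → ℕ → ℕ → ℂ := fun t k χ c d =>
    bInner (sg * a) (δ * q₀) H (2 * N) (betaStar sg N β T t v η) c d k χ with hSf
  set Yt : ℕ → (k : ℕ) → DirichletCharacter ℂ (δ * q₀ * k) → ℕ → ℕ → ℝ := fun t k χ q₁ q₂ =>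
    ∑ n₁ ∈ dyadic N, |β n₁| * ‖Sf t k χ (n₁ * q₂) q₁‖ with hYt
  have hYt0 : ∀ t k χ q₁ q₂, 0 ≤ Yt t k χ q₁ q₂ := fun t k χ q₁ q₂ =>
    Finset.sum_nonneg fun _ _ => mul_nonneg (abs_nonneg _) (norm_nonneg _)
  -- Step 1: the bound for `nnSum` from Stage B
  have hnn : ∀ k ∈ Kset, ∀ q₁ ∈ S, ∀ q₂ ∈ S,
      ‖nnSum a sg N R H β q₀ δ k q₁ q₂ v η‖ ≤
        ((Nat.totient (δ * q₀ * k) : ℝ))⁻¹ * (T : ℝ)⁻¹ *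
          ∑ χ : DirichletCharacter ℂ (δ * q₀ * k), ∑ t ∈ Finset.range T, gB t * Yt t k χ q₁ q₂ := by
    intro k hk q₁ hq₁ q₂ hq₂
    have hk0 := hKpos k hk
    haveI : NeZero (δ * q₀ * k) := ⟨(Nat.mul_pos hm hk0).ne'⟩
    have heq := detected_sum_eq a hR.le hN β H hq₀ hδ hk0 hT (hclose k hk) v η
      (sg := sg) (q₁ := q₁) (q₂ := q₂)
    unfold nnSum
    rw [heq]
    rw [norm_mul, norm_mul, norm_inv, norm_inv, Complex.norm_natCast, Complex.norm_natCast]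
    refine mul_le_mul_of_nonneg_left ?_ (by positivity)
    refine (norm_sum_le _ _).trans (Finset.sum_le_sum fun χ _ => ?_)
    refine (norm_sum_le _ _).trans (Finset.sum_le_sum fun t _ => ?_)
    rw [norm_mul]
    refine mul_le_mul (norm_gkFun_le hVg (hlen k hk) t) ?_ (norm_nonneg _) (hgB0 t)
    refine (norm_sum_le _ _).trans (Finset.sum_le_sum fun n₁ _ => ?_)
    rw [norm_mul]
    refine mul_le_mul ?_ le_rfl (norm_nonneg _) (abs_nonneg _)
    rw [norm_mul, norm_mul, Complex.norm_real, Real.norm_eq_abs]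
    have h1 : ‖starRingEnd ℂ (χ (n₁ : ZMod (δ * q₀ * k)))‖ ≤ 1 := by
      rw [RCLike.norm_conj]; exact DirichletCharacter.norm_le_one χ _
    have h2 : ‖starRingEnd ℂ (twist sg T t v η n₁)‖ = 1 := by
      rw [RCLike.norm_conj]; unfold twist; rw [norm_mul, Circle.norm_coe, Circle.norm_coe, mul_one]
    rw [h2, mul_one]
    calc |β n₁| * ‖starRingEnd ℂ (χ (n₁ : ZMod (δ * q₀ * k)))‖ ≤ |β n₁| * 1 :=
          mul_le_mul_of_nonneg_left h1 (abs_nonneg _)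
      _ = |β n₁| := mul_one _
  -- Step 2: the bound for each `(k, q₁, q₂)`-term of `J`
  have hterm : ∀ k ∈ Kset, ∀ q₁ ∈ S, ∀ q₂ ∈ S,
      ‖(if q₁.Coprime q₂ ∧ (q₀ * q₁ * q₂).Coprime a.natAbs then
        ((γ (q₀ * q₁) * γ (q₀ * q₂) : ℝ) : ℂ) *
          (((lamVal k q₁ q₂ : ℝ) : ℂ) * 𝓕 (bumpC M Y) (lamVal k q₁ q₂ * η)) *
            nnSum a sg N R H β q₀ δ k q₁ q₂ v η else 0 : ℂ)‖ ≤
        Φ * (T : ℝ)⁻¹ * ∑ t ∈ Finset.range T, gB t * (|γ (q₀ * q₁)| * |γ (q₀ * q₂)| *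
          (((Nat.totient (δ * q₀ * k) : ℝ))⁻¹ *
            ∑ χ : DirichletCharacter ℂ (δ * q₀ * k), Yt t k χ q₁ q₂)) := by
    intro k hk q₁ hq₁ q₂ hq₂
    have hrhs0 : 0 ≤ Φ * (T : ℝ)⁻¹ * ∑ t ∈ Finset.range T, gB t * (|γ (q₀ * q₁)| * |γ (q₀ * q₂)| *
        (((Nat.totient (δ * q₀ * k) : ℝ))⁻¹ *
          ∑ χ : DirichletCharacter ℂ (δ * q₀ * k), Yt t k χ q₁ q₂)) := by
      refine mul_nonneg (mul_nonneg hΦ0 (by positivity)) (Finset.sum_nonneg fun t _ => ?_)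
      refine mul_nonneg (hgB0 t) (mul_nonneg (by positivity) (mul_nonneg (by positivity) ?_))
      exact Finset.sum_nonneg fun χ _ => hYt0 t k χ q₁ q₂
    split_ifs with hP
    swap
    · rw [norm_zero]; exact hrhs0
    have hlv := hlam k hk q₁ hq₁ q₂ hq₂
    have hlv0 : 0 < lamVal k q₁ q₂ := hl₁.trans_le hlv.1
    have hF : ‖(((lamVal k q₁ q₂ : ℝ) : ℂ) * 𝓕 (bumpC M Y) (lamVal k q₁ q₂ * η))‖ ≤ Φ := by
      rw [norm_mul, Complex.norm_real, Real.norm_eq_abs, abs_of_pos hlv0]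
      exact mul_norm_fourier_bumpC_le_lorentz hY hM hl₁ hlv.1 hlv.2 η
    rw [norm_mul, norm_mul, Complex.norm_real, Real.norm_eq_abs, abs_mul]
    calc |γ (q₀ * q₁)| * |γ (q₀ * q₂)| *
          ‖(((lamVal k q₁ q₂ : ℝ) : ℂ) * 𝓕 (bumpC M Y) (lamVal k q₁ q₂ * η))‖ *
          ‖nnSum a sg N R H β q₀ δ k q₁ q₂ v η‖
        ≤ |γ (q₀ * q₁)| * |γ (q₀ * q₂)| * Φ * (((Nat.totient (δ * q₀ * k) : ℝ))⁻¹ * (T : ℝ)⁻¹ *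
          ∑ χ : DirichletCharacter ℂ (δ * q₀ * k), ∑ t ∈ Finset.range T, gB t * Yt t k χ q₁ q₂) := by
          gcongr
          exact hnn k hk q₁ hq₁ q₂ hq₂
      _ = _ := by
          rw [Finset.sum_comm]
          simp only [Finset.mul_sum]
          refine Finset.sum_congr rfl fun t _ => Finset.sum_congr rfl fun χ _ => ?_
          ring
  -- Step 3: sum over `k, q₁, q₂` and reorder
  have hJ : ‖etaIntegrand a sg M Y N Q R H β γ q₀ δ Kset v η‖ ≤
      Φ * (T : ℝ)⁻¹ * ∑ t ∈ Finset.range T, gB t *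
        ∑ k ∈ Kset, ((Nat.totient (δ * q₀ * k) : ℝ))⁻¹ *
          ∑ χ : DirichletCharacter ℂ (δ * q₀ * k), ∑ q₁ ∈ S, ∑ q₂ ∈ S, ∑ n₁ ∈ dyadic N,
            |γ (q₀ * q₁)| * |γ (q₀ * q₂)| * |β n₁| * ‖Sf t k χ (n₁ * q₂) q₁‖ := by
    unfold etaIntegrand
    rw [← hS]
    refine (norm_sum_le _ _).trans ?_
    refine (Finset.sum_le_sum fun k hk => (norm_sum_le _ _).trans
      (Finset.sum_le_sum fun q₁ hq₁ => (norm_sum_le _ _).trans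
        (Finset.sum_le_sum fun q₂ hq₂ => hterm k hk q₁ hq₁ q₂ hq₂))).trans (le_of_eq ?_)
    -- pull out `Φ T⁻¹` and bring `t` outside
    simp only [← Finset.mul_sum]
    congr 1
    rw [sum_comm₄]
    refine Finset.sum_congr rfl fun t _ => ?_
    simp only [Finset.mul_sum]
    refine Finset.sum_congr rfl fun k _ => ?_
    rw [sum_comm₃]
    refine Finset.sum_congr rfl fun χ _ => Finset.sum_congr rfl fun q₁ _ =>
      Finset.sum_congr rfl fun q₂ _ => ?_
    simp only [hYt, Finset.mul_sum]
    refine Finset.sum_congr rfl fun n₁ _ => ?_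
    ring
  -- Step 4: Cauchy's inequality with multiplicity, for each `t`
  have hCS : ∀ t : ℕ, ∑ k ∈ Kset, ((Nat.totient (δ * q₀ * k) : ℝ))⁻¹ *
      ∑ χ : DirichletCharacter ℂ (δ * q₀ * k), ∑ q₁ ∈ S, ∑ q₂ ∈ S, ∑ n₁ ∈ dyadic N,
        |γ (q₀ * q₁)| * |γ (q₀ * q₂)| * |β n₁| * ‖Sf t k χ (n₁ * q₂) q₁‖ ≤
      Real.sqrt (Kset.card * ((∑ q ∈ S, γ (q₀ * q) ^ 2) * (∑ q ∈ S, γ (q₀ * q) ^ 2) *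
          ∑ n ∈ dyadic N, β n ^ 2)) * Real.sqrt (Dτ * L) := by
    intro t
    have hS₁ : S ⊆ Icc 1 ⌊2 * Q⌋₊ := Finset.filter_subset _ _
    have hC : ∀ q₂ ∈ S, ∀ n₁ ∈ dyadic N, n₁ * q₂ ∈ Icc 1 ⌊4 * N * Q⌋₊ := by
      intro q₂ hq₂ n₁ hn₁
      have hb := qSet_bounds hQ.le hq₀ hq₂
      have hn := (mem_dyadic hN).1 hn₁
      rw [Finset.mem_Icc]
      constructor
      · exact Nat.one_le_iff_ne_zero.2 (Nat.mul_ne_zero (by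
          rintro rfl; simp at hn; linarith) (by omega))
      · refine Nat.le_floor ?_
        push_cast
        have hq0 : (1 : ℝ) ≤ q₀ := by exact_mod_cast hq₀
        have h2 : (q₂ : ℝ) ≤ 2 * Q := by
          calc (q₂ : ℝ) ≤ 2 * Q / q₀ := hb.2.2
            _ ≤ 2 * Q := div_le_self (by positivity) hq0
        have hn2 : (n₁ : ℝ) ≤ 2 * N := hn.2
        have hn0 : (0 : ℝ) ≤ n₁ := by positivity
        nlinarith
    have hmult : ∀ c, ((S ×ˢ dyadic N).filter (fun p : ℕ × ℕ => p.2 * p.1 = c)).card ≤ Dτ := by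
      intro c
      by_cases hc : ((S ×ˢ dyadic N).filter (fun p : ℕ × ℕ => p.2 * p.1 = c)).Nonempty
      · obtain ⟨p, hp⟩ := hc
        rw [Finset.mem_filter, Finset.mem_product] at hp
        have hcmem : c ∈ Icc 1 ⌊4 * N * Q⌋₊ := by rw [← hp.2]; exact hC p.1 hp.1.1 p.2 hp.1.2
        exact (card_fiber_mul_le S (dyadic N) (fun n hn => pos_of_mem_dyadic hN hn) hSpos c).trans
          (hDτ c hcmem)
      · rw [Finset.not_nonempty_iff_eq_empty.1 hc, Finset.card_empty]; exact Nat.zero_le _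
    have h := sum_weighted_norm_le hm Kset S S (dyadic N) hKpos (fun q => γ (q₀ * q))
      (fun q => γ (q₀ * q)) β (Sf t) hS₁ hC hmult
    refine h.trans ?_
    refine mul_le_mul_of_nonneg_left ?_ (Real.sqrt_nonneg _)
    refine Real.sqrt_le_sqrt (mul_le_mul_of_nonneg_left ?_ (Nat.cast_nonneg _))
    refine le_trans ?_ (hL t v η)
    rw [dispBm_eq_sum_k]
    refine Finset.sum_le_sum_of_subset_of_nonneg hKsub fun k _ _ => ?_
    exact mul_nonneg (inv_nonneg.2 (Nat.cast_nonneg _)) (Finset.sum_nonneg fun _ _ =>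
      Finset.sum_nonneg fun _ _ => Finset.sum_nonneg fun _ _ => sq_nonneg _)
  -- Step 5: assemble
  refine hJ.trans ?_
  have hsumg : ∑ t ∈ Finset.range T, gB t ≤ 2 * Vg + T * (1 + Real.log T) :=
    sum_range_geomBound_div_le hT hVg
  set CS : ℝ := Real.sqrt (Kset.card * ((∑ q ∈ S, γ (q₀ * q) ^ 2) * (∑ q ∈ S, γ (q₀ * q) ^ 2) *
    ∑ n ∈ dyadic N, β n ^ 2)) * Real.sqrt (Dτ * L) with hCSdef
  have hCS0 : 0 ≤ CS := by positivity
  calc Φ * (T : ℝ)⁻¹ * ∑ t ∈ Finset.range T, gB t *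
        ∑ k ∈ Kset, ((Nat.totient (δ * q₀ * k) : ℝ))⁻¹ *
          ∑ χ : DirichletCharacter ℂ (δ * q₀ * k), ∑ q₁ ∈ S, ∑ q₂ ∈ S, ∑ n₁ ∈ dyadic N,
            |γ (q₀ * q₁)| * |γ (q₀ * q₂)| * |β n₁| * ‖Sf t k χ (n₁ * q₂) q₁‖
      ≤ Φ * (T : ℝ)⁻¹ * ∑ t ∈ Finset.range T, gB t * CS := by
        refine mul_le_mul_of_nonneg_left (Finset.sum_le_sum fun t _ =>
          mul_le_mul_of_nonneg_left (hCS t) (hgB0 t)) (mul_nonneg hΦ0 (by positivity))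
    _ = Φ * ((T : ℝ)⁻¹ * ∑ t ∈ Finset.range T, gB t) * CS := by
        rw [← Finset.sum_mul]; ring
    _ ≤ Φ * ((T : ℝ)⁻¹ * (2 * Vg + T * (1 + Real.log T))) * CS := by
        gcongr

/-- **The core bound** (BFI §9, (9.1)–(9.13) made rigorous): for a block `𝒦` of values of `k`
on which `λ = k/(q₁q₂) ∈ [λ₁, λ₂]`,
`|Core_σ(δ; 𝒦)| ≤ V · 2π(λ₂(M+2Y)B₀/λ₁)^{1/2} · T⁻¹(2V_g + T(1+log T)) · (#𝒦 Γ² ‖β‖²)^{1/2} (D_τ L)^{1/2}`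
with `V ≥ 3Mq₀/(Q²R)` (the length of the `ξ`-integral, BFI's `Y`), the second factor the
`η`-integral of the majorant ((9.11)), the third the average of the geometric-sum majorant ((9.9)),
and the last two Cauchy's inequality ((9.13)) against the hypothesis `𝓑_m ≤ L` (Lemma 7's role).
[cite: BombieriFriedlanderIwaniecActa1986, §9 (9.1)–(9.13) pp. 227–229] -/
theorem norm_coreSum_le (a sg : ℤ) {M Y : ℝ} (hY : 0 < Y) (hYM : Y ≤ M) {N Q R : ℝ}
    (hN : 0 ≤ N) (hQ : 0 < Q) (hR : 0 < R) {H : ℝ} (hH : 0 ≤ H) (β γ : ℕ → ℝ) {q₀ δ : ℕ}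
    (hq₀ : 0 < q₀) (hδ : 0 < δ) {Kset : Finset ℕ} (hKsub : Kset ⊆ Icc 1 ⌊N / R⌋₊)
    {lam₁ lam₂ : ℝ} (hl₁ : 0 < lam₁) (hl₁₂ : lam₁ ≤ lam₂)
    (hlam : ∀ k ∈ Kset, ∀ q₁ ∈ qSet Q q₀, ∀ q₂ ∈ qSet Q q₀,
      lam₁ ≤ lamVal k q₁ q₂ ∧ lamVal k q₁ q₂ ≤ lam₂)
    {T : ℕ} (hT : 0 < T)
    (hclose : ∀ k ∈ Kset, ∀ n₁ ∈ dyadic N, ∀ n₂ ∈ dyadic N,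
      ∀ s ∈ Finset.Ioc ⌊(q₀ : ℝ) * k * R⌋₊ ⌊2 * ((q₀ : ℝ) * k * R)⌋₊,
        |sg * ((n₂ : ℤ) - n₁) - (s : ℤ)| < T)
    {Vg : ℝ} (hVg : 0 ≤ Vg)
    (hlen : ∀ k ∈ Kset, (⌊2 * ((q₀ : ℝ) * k * R)⌋₊ : ℝ) - ⌊(q₀ : ℝ) * k * R⌋₊ ≤ Vg)
    {Dτ : ℕ} (hDτ : ∀ c ∈ Icc 1 ⌊4 * N * Q⌋₊, c.divisors.card ≤ Dτ)
    {L : ℝ} (hL : ∀ (t : ℕ) (v η : ℝ),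
      dispBm (sg * a) (δ * q₀) (4 * N * Q) (2 * Q) (N / R) H (2 * N) (betaStar sg N β T t v η) ≤ L)
    {V : ℝ} (hV0 : 0 ≤ V) (hV : 3 * M * q₀ / (Q ^ 2 * R) ≤ V) :
    ‖coreSum a sg M Y N Q R H β γ q₀ δ Kset‖ ≤
      V * (2 * π * Real.sqrt (lam₂ * (M + 2 * Y) * (fourierDecayConst Y / lam₁))) *
        ((T : ℝ)⁻¹ * (2 * Vg + T * (1 + Real.log T))) *
        (Real.sqrt (Kset.card * ((∑ q ∈ qSet Q q₀, γ (q₀ * q) ^ 2) *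
            (∑ q ∈ qSet Q q₀, γ (q₀ * q) ^ 2) * ∑ n ∈ dyadic N, β n ^ 2)) *
          Real.sqrt (Dτ * L)) := by
  have hM : 0 ≤ M := hY.le.trans hYM
  have hKpos : ∀ k ∈ Kset, 0 < k := fun k hk => (Finset.mem_Icc.1 (hKsub hk)).1
  set Av : ℝ := (T : ℝ)⁻¹ * (2 * Vg + T * (1 + Real.log T)) with hAv
  set CS : ℝ := Real.sqrt (Kset.card * ((∑ q ∈ qSet Q q₀, γ (q₀ * q) ^ 2) *
    (∑ q ∈ qSet Q q₀, γ (q₀ * q) ^ 2) * ∑ n ∈ dyadic N, β n ^ 2)) * Real.sqrt (Dτ * L) with hCSd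
  have ha0 : 0 < lam₂ * (M + 2 * Y) := by
    have := hl₁.trans_le hl₁₂; have : 0 < M + 2 * Y := by linarith
    positivity
  have hb0 : 0 < fourierDecayConst Y / lam₁ := div_pos (fourierDecayConst_pos hY) hl₁
  have hT0 : (0 : ℝ) < T := by exact_mod_cast hT
  have hAv0 : 0 ≤ Av := by
    have h1 : 0 ≤ Real.log T := Real.log_nonneg (by exact_mod_cast hT)
    positivity
  have hCS0 : 0 ≤ CS := by positivity
  -- pointwise bound for `I(v)`
  have hI : ∀ v : ℝ, ‖vIntegrand a sg M Y N Q R H β γ q₀ δ Kset v‖ ≤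
      (2 * π * Real.sqrt (lam₂ * (M + 2 * Y) * (fourierDecayConst Y / lam₁))) * Av * CS := by
    intro v
    rw [vIntegrand_eq_integral a sg hY hYM hQ.le R hH β γ hq₀ δ hKpos v]
    have hg : Integrable (fun η : ℝ =>
        lorentz (lam₂ * (M + 2 * Y)) (fourierDecayConst Y / lam₁) η * Av * CS) :=
      ((integrable_lorentz ha0 hb0).mul_const Av).mul_const CS
    refine (norm_integral_le_of_norm_le hg (Filter.Eventually.of_forall fun η =>
      norm_etaIntegrand_le a sg hY hYM hN hQ hR H β γ hq₀ hδ hKsub hl₁ hl₁₂ hlam hT hclose hVg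
        hlen hDτ hL v η)).trans (le_of_eq ?_)
    rw [integral_mul_const, integral_mul_const, integral_lorentz ha0 hb0]
  -- integrate over `0 < v ≤ V`
  rw [coreSum_eq_integral a sg hY hYM hQ hR H β γ hq₀ hKpos hV (δ := δ)]
  have hvol : volume (Set.Ioc (0 : ℝ) V) < ⊤ := by
    rw [Real.volume_Ioc]; exact ENNReal.ofReal_lt_top
  refine (norm_setIntegral_le_of_norm_le_const hvol fun v _ => hI v).trans (le_of_eq ?_)
  rw [Measure.real, Real.volume_Ioc, ENNReal.toReal_ofReal (by linarith)]
  ring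

end BFI

end Literature.NumberTheory.Sieve
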